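import Literature.NumberTheory.EllipticCurves.IsogenyDualProofs
import HarnessLib

/-!
# Silverman, *AEC*, Cor. III.4.11 for separable isogenies, Thm. III.4.10(c), and the dual of a separable isogeny (Thm. III.6.1(a)) in any characteristic

D-0014 keeps `Literature/` sorry-free by stating cited results as named facts `def X : Prop`.
A *proofs* file over the prelude `Literature.NumberTheory.EllipticCurves.Isogeny`, on top of the
tree's `IsogenyFactorProofs` (Cor. III.4.11 for `φ = [m]`, `deg [m] = m²`),
`IsogenyDegreeKernelProofs` (Thm. III.4.10(a): `#ker φ = deg_s φ`; the embedding
`φ^* = Isogeny.pullbackHom`; places ↔ points) and `IsogenyDualProofs` (Thm. II.2.3: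
`Isogeny.surjective`; the dual isogeny **in characteristic `0`**). It proves, for the prelude's
isogenies of elliptic curves over an arbitrary field `K` (so in particular over finite fields,
where the characteristic-`0` dual of `IsogenyDualProofs` is not available):

* **Cor. III.4.11 in general** — `WeierstrassCurve.Isogeny.exists_eq_comp_of_ker_le`: for
  isogenies `φ : E → E'`, `ψ : E → E''` over `K` with `ker φ ⊆ ker ψ` and `deg φ ≤ #ker φ`, there
  is an isogeny `λ : E' → E''` over `K` with `ψ = λ ∘ φ`. Silverman's hypothesis "`φ` separable"
  is `deg φ ≤ #ker φ`: **Thm. III.4.10(c)** — `Isogeny.deg_le_card_ker_iff_isSeparable`: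
  `deg φ ≤ #ker φ` (equivalently `deg φ = #ker φ`) iff `K̄(E)/φ^* K̄(E')` is separable — from (a)
  (`card_ker_eq_finSepDegree_holds`) and `deg_s ∣ deg`; separable form
  `exists_eq_comp_of_ker_le_of_isSeparable`.
* **Thm. III.4.10(b) for separable `φ`** — `Isogeny.pullbackField_eq_fixedField_of_deg_le`:
  `φ^* K̄(E') = K̄(E)^{ker φ}` as soon as `deg φ ≤ #ker φ` (the tree has it for `φ = [m]`,
  `Isogeny.pullbackField_zsmul_eq_fixedField`, and in characteristic `0`,
  `Isogeny.pullbackField_eq_fixedField_of_charZero`).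
* **Thm. III.6.1(a), Thm. III.6.2(a) for separable `φ`, any characteristic** —
  `Isogeny.exists_dual_of_deg_le_card_ker`: an isogeny `φ̂ : E' → E` over `K` with
  `φ̂ ∘ φ = [#ker φ]` and `φ ∘ φ̂ = [#ker φ]`; `Isogeny.nonempty_symm_of_deg_le_card_ker`.
* **Cor. III.5.4** — `isSeparable_pullbackField_zsmul`: `[m]` is separable for `m ≠ 0` in `K`
  (`deg [m] = m² = #E[m]`, the tree's `Isogeny.deg_zsmul`, `Isogeny.degree_zsmul`).

These serve the quotient-isogeny input of Tate's theorem for elliptic curves over finite fields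
(`Literature.AlgebraicGeometry.Motives.FaltingsECTateMainTheoremProofs`, hypothesis `hquot` =
`WeierstrassCurve.exists_isogeny_ker_eq_and_comp_eq_nsmul`): with the separable dual available in
characteristic `p`, `hquot` reduces to the existence of the separable quotient `E → E/S` alone
(sibling `IsogenyQuotientProofs`).

## The arguments

**Cor. III.4.11.** Silverman: "`φ` separable ⟹ `K̄(E₁)/φ^* K̄(E₂)` is Galois [III.4.10(b)] with
group `ker φ` acting by the translations `τ_T^*`; since `ker φ ⊆ ker ψ`, every `τ_T^*`, `T ∈ ker φ`,
fixes `ψ^* K̄(E₃)`, hence `ψ^* K̄(E₃) ⊆ φ^* K̄(E₂)`, and the inclusion of fields gives `λ`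
[II.2.4(b)]." With the tree's function-field calculus (`FunctionFieldTranslation`: values
`HasValueAt`, the translations `τ_T^*` with `(τ_T^* z)(P) = z(P + T)`, Artin's theorem for
`{τ_T^*}`; `IsogenyDegree`: `φ^* K̄(E') = K̄(φ^* x', φ^* y')`, `deg`; `IsogenyDegreeKernelProofs`:
`φ^* = Isogeny.pullbackHom`):

1. **`(φ^* z)(P) = z(φ P)`** at the points of agreement of `φ` (`HasValueAt.pullbackHom`, for
   every `z ∈ K̄(E')`; the tree has it for regular `z` and for quotients `g/h`).
2. **`L := φ^* K̄(E') ⊆ H := K̄(E)^{ker φ}`** (the tree's `Isogeny.pullbackField_le_fixedField`) with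
   `[K̄(E) : H] = #ker φ` (Artin), so **`L = H` as soon as `deg φ = [K̄(E) : L] ≤ #ker φ`**
   (`pullbackField_eq_fixedField_of_deg_le`).
3. **Assembly** (`exists_eq_comp_of_ker_le_of_surjective`; the surjectivity hypothesis is then
   discharged by the tree's `Isogeny.surjective`, Thm. II.2.3): for `ψ` with `ker φ ⊆ ker ψ`,
   `ψ^* x'', ψ^* y'' ∈ H = L` (the tree's `Isogeny.transAlgHom_pullbackX/Y`), so
   `ψ^* x'' = φ^* (g₁/h₁)`, `ψ^* y'' = φ^* (g₂/h₂)`; the map `λ(φ P) := ψ(P)` is well defined,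
   additive, `Γ_K`-equivariant, of finite kernel `φ(ker ψ)`, and by step 1 it agrees with
   `(g₁/h₁, g₂/h₂)` at `Q = φ P` for every `P` off a finite set — hence off a finite set of `Q`.

**Thm. III.6.1(a)** (Silverman's proof in the separable case): with `n = #ker φ`, `[n]` kills
`ker φ` (Lagrange), so `[n] = φ̂ ∘ φ` by Cor. III.4.11, and `φ (φ̂ (φ P)) = φ (n • P) = n • φ P`
with `φ` onto gives `φ ∘ φ̂ = [n]` (Thm. III.6.2(a)).

## Contents (theorems only)

* `Isogeny.hasValueAt_pullback_gen`, `Isogeny.pullbackHom_evalGeneric`, `HasValueAt.pullbackHom`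
  (values of pull-backs at the points of agreement of `φ` with its chosen rational representation
  `Isogeny.rationalRep`).
* `Isogeny.pullbackField_eq_fixedField_of_deg_le`, `Isogeny.mem_fixedField_of_forall_transAlgHom_eq`,
  `Isogeny.pullback_mem_pullbackField_of_ker_le`, `Isogeny.exists_eq_comp_of_ker_le_of_surjective`.
* **`Isogeny.exists_eq_comp_of_ker_le`**, **`Isogeny.deg_le_card_ker_iff_isSeparable`**,
  `Isogeny.exists_eq_comp_of_ker_le_of_isSeparable`.
* `deg_zsmul_le_card_ker`, `isSeparable_pullbackField_zsmul`.
* **`Isogeny.exists_dual_of_deg_le_card_ker`**, `Isogeny.nonempty_symm_of_deg_le_card_ker`.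

## Faithfulness

The prelude's `Isogeny W W'` is Silverman's `K`-rational isogeny read through its map on
`K̄`-points (see the docstrings of `Isogeny` and `IsogenyHom`); the `λ` of
`exists_eq_comp_of_ker_le` is the map on points of Silverman's `λ` (it satisfies `ψ = λ ∘ φ`
pointwise and `φ` is onto, so it is the only such map), and its `Γ_K`-equivariance is the remark in
`IsogenyHom`'s docstring ("`λ` is defined over `K` by uniqueness"). Silverman's hypothesis
"`φ` separable" means that `K(E₁)/φ^* K(E₂)` is a separable extension (II.§2, p. 21); by
`deg_le_card_ker_iff_isSeparable` this is the hypothesis `deg φ ≤ #ker φ` used here. The dual of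
`exists_dual_of_deg_le_card_ker` satisfies the defining property `φ̂ ∘ φ = [deg φ]` of III.6.1(a)
with `deg φ = #ker φ` (III.4.10(c)).

## References

* [SilvermanAEC2009] J. H. Silverman, *The Arithmetic of Elliptic Curves*, 2nd ed., GTM 106,
  Springer 2009: II.§2 (pp. 20–24: `φ^*`, separable maps, Thm. II.2.3, Thm. II.2.4), III.§4
  (Thm. III.4.10(a)–(c), **Cor. III.4.11**, pp. 72–73), III.§5 (Cor. III.5.4), III.§6
  (**Thm. III.6.1(a)** and its proof, Thm. III.6.2(a)).
* E. Artin, *Galois Theory* (1944), Thm. 14, as Mathlib's `FixedPoints.finrank_eq_card`.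

## Design

`noncomputable section`, `open scoped Classical`, `K : Type u`, everything over
`K̄ = AlgebraicClosure K`, dot-notation extensions in `namespace WeierstrassCurve`, as in the files
built upon. Values are computed through the chosen rational representation `Isogeny.rationalRep`
(whose finite exceptional set is the tree's `Isogeny.badSet φ`); no definition is introduced.
-/

noncomputable section

open scoped Classical
open scoped Polynomial.Bivariate
open Polynomial

universe u

namespace WeierstrassCurve

open geomPoints

variable {K : Type u} [Field K] {W W' : WeierstrassCurve K}

/-! ## Values of pull-backs: `(φ^* z)(P) = z(φ P)` -/

section PullbackValues

namespace Isogeny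

variable (φ : Isogeny W W')

/-- **`φ^* x'` and `φ^* y'` have the values `x'(φ P)`, `y'(φ P)` at a point of agreement `P`.**
Silverman, *AEC*, II.§2 (`(φ^* f)(P) = f(φ P)`). [folklore] -/
theorem hasValueAt_pullback_gen {P : W.geomPoints}
    (hP : AgreesWithRationalMapAt W W' φ.rationalRep.P₁ φ.rationalRep.Q₁ φ.rationalRep.P₂
      φ.rationalRep.Q₂ φ P) (i : Fin 2) :
    W.HasValueAt (![φ.pullbackX, φ.pullbackY] i) P (xy (φ P) i) := by
  obtain ⟨hP0, hQ₁, hQ₂, h', e⟩ := agreesWithRationalMapAt_iff.mp hP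
  rw [e, xy_some]
  fin_cases i
  · exact hasValueAt_div hP0 hQ₁ (g := φ.rationalRep.P₁)
  · exact hasValueAt_div hP0 hQ₂ (g := φ.rationalRep.P₂)

/-- `(g(φ^* x', φ^* y'))(P) = g(φ P)` at a point of agreement. [folklore] -/
theorem hasValueAt_aeval_pullback {P : W.geomPoints}
    (hP : AgreesWithRationalMapAt W W' φ.rationalRep.P₁ φ.rationalRep.Q₁ φ.rationalRep.P₂
      φ.rationalRep.Q₂ φ P) (g : MvPolynomial (Fin 2) (AlgebraicClosure K)) :
    W.HasValueAt (MvPolynomial.aeval ![φ.pullbackX, φ.pullbackY] g) P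
      (MvPolynomial.eval (xy (φ P)) g) :=
  HasValueAt.aeval (φ.hasValueAt_pullback_gen hP) g

variable [W.IsElliptic]

/-- `φ^*` acts on `g(x', y')` by `g ↦ g(φ^* x', φ^* y')`. [folklore] -/
theorem pullbackHom_evalGeneric (g : MvPolynomial (Fin 2) (AlgebraicClosure K)) :
    φ.pullbackHom (W'.evalGeneric g) = MvPolynomial.aeval ![φ.pullbackX, φ.pullbackY] g := by
  rw [algHom_evalGeneric, pullbackHom_genX, pullbackHom_genY]

/-- **`(φ^* z)(P) = z(φ P)`**: if `z ∈ K̄(E')` has value `c` at `φ P` and `P` is a point of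
agreement of `φ`, then `φ^* z` has value `c` at `P` (for regular `z` this is the tree's
`hasValueAt_pullbackHom_algebraMap`). Silverman, *AEC*, II.§2 (p. 20: `φ^* f = f ∘ φ`). [folklore] -/
theorem _root_.WeierstrassCurve.HasValueAt.pullbackHom {P : W.geomPoints}
    (hP : AgreesWithRationalMapAt W W' φ.rationalRep.P₁ φ.rationalRep.Q₁ φ.rationalRep.P₂
      φ.rationalRep.Q₂ φ P)
    {z : W'.geomFunctionField} {c : AlgebraicClosure K} (h : W'.HasValueAt z (φ P) c) :
    W.HasValueAt (φ.pullbackHom z) P c := by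
  have hP0 : P ≠ 0 := (agreesWithRationalMapAt_iff.mp hP).1
  obtain ⟨g, h, hh, hz, hg⟩ := h
  have hvh := φ.hasValueAt_aeval_pullback hP h
  have hvg := φ.hasValueAt_aeval_pullback hP g
  have hne : φ.pullbackHom (W'.evalGeneric h) ≠ 0 := by
    rw [pullbackHom_evalGeneric]
    exact hvh.ne_zero hP0 hh
  have hz' : φ.pullbackHom z = φ.pullbackHom (W'.evalGeneric g) /
      φ.pullbackHom (W'.evalGeneric h) := by
    rw [eq_div_iff hne, ← map_mul, hz]
  rw [hz', pullbackHom_evalGeneric, pullbackHom_evalGeneric]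
  refine (hvg.div hP0 hvh hh).congr rfl ?_
  rw [hg, mul_div_cancel_right₀ _ hh]

end Isogeny

end PullbackValues

/-! ## Silverman, *AEC*, Cor. III.4.11: factoring an isogeny through a separable one (given surjectivity) -/

section Factor

variable [W.IsElliptic] {W'' : WeierstrassCurve K}

namespace Isogeny

/-- **`φ^* K̄(E') = K̄(E)^{ker φ}` when `deg φ = #ker φ`** (i.e. when `φ` is separable, Silverman,
*AEC*, Thm. III.4.10(c)): `φ^* K̄(E')` lies in the fixed field of the translations by `ker φ`
(`pullbackField_le_fixedField`), whose codegree is `#ker φ` by Artin's theorem, and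
`[K̄(E) : φ^* K̄(E')] = deg φ`. Silverman, *AEC*, Thm. III.4.10(b) ("`K̄(E₁)/φ^* K̄(E₂)` is Galois
with group `ker φ`"). [cite: SilvermanAEC2009, Thm. III.4.10(b)] -/
theorem pullbackField_eq_fixedField_of_deg_le [W'.IsElliptic] (φ : Isogeny W W')
    (hdeg : φ.deg ≤ Nat.card φ.toAddMonoidHom.ker) :
    φ.pullbackField = IntermediateField.fixedField
      ((AddSubgroup.toSubgroup φ.toAddMonoidHom.ker).map W.transHom) := by
  set H : Subgroup (W.geomFunctionField ≃ₐ[AlgebraicClosure K] W.geomFunctionField) :=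
    (AddSubgroup.toSubgroup φ.toAddMonoidHom.ker).map W.transHom with hH
  haveI : FiniteDimensional φ.pullbackField W.geomFunctionField :=
    Isogeny.finiteDimensional_pullbackField_holds W W' φ
  have hcardK : Nat.card (AddSubgroup.toSubgroup φ.toAddMonoidHom.ker) =
      Nat.card φ.toAddMonoidHom.ker :=
    Nat.card_congr (Equiv.subtypeEquiv Multiplicative.toAdd fun _ ↦ Iff.rfl)
  have hcard : Nat.card H = Nat.card φ.toAddMonoidHom.ker := by
    rw [hH, Subgroup.card_map_of_injective transHom_injective, hcardK]
  haveI : Finite (AddSubgroup.toSubgroup φ.toAddMonoidHom.ker) :=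
    Nat.finite_of_card_ne_zero (by
      rw [hcardK]; exact (Nat.card_pos (α := φ.toAddMonoidHom.ker)).ne')
  haveI : Finite H := by
    rw [hH]
    exact Finite.of_surjective _ (Subgroup.equivMapOfInjective _ _ transHom_injective).surjective
  letI : Fintype H := Fintype.ofFinite H
  have h1 : Module.finrank (IntermediateField.fixedField H) W.geomFunctionField = Fintype.card H :=
    FixedPoints.finrank_eq_card H W.geomFunctionField
  refine IntermediateField.eq_of_le_of_finrank_le' φ.pullbackField_le_fixedField ?_
  rw [h1, ← Nat.card_eq_fintype_card, hcard]
  exact hdeg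

omit [W.IsElliptic] in
/-- An element of `K̄(E)` fixed by the translations `τ_T^*`, `T ∈ ker φ`, lies in the fixed field
of `{τ_T^* : T ∈ ker φ}`. [folklore] -/
theorem mem_fixedField_of_forall_transAlgHom_eq [W.IsElliptic] (φ : Isogeny W W')
    {z : W.geomFunctionField} (hz : ∀ T : W.geomPoints, φ T = 0 → W.transAlgHom T z = z) :
    z ∈ IntermediateField.fixedField
      ((AddSubgroup.toSubgroup φ.toAddMonoidHom.ker).map W.transHom) := by
  rw [IntermediateField.mem_fixedField_iff]
  rintro f hf
  obtain ⟨g, hg, rfl⟩ := Subgroup.mem_map.mp hf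
  have hg' : φ g.toAdd = 0 := by simpa using hg
  exact hz g.toAdd hg'

/-- **`ker φ ⊆ ker ψ` ⟹ `ψ^* x'', ψ^* y'' ∈ φ^* K̄(E')`** for `φ` with `deg φ = #ker φ`: the
pull-backs along `ψ` are fixed by the translations `τ_T^*`, `T ∈ ker φ ⊆ ker ψ`
(`transAlgHom_pullbackX/Y`), hence lie in `K̄(E)^{ker φ} = φ^* K̄(E')`. Silverman, *AEC*, proof
of Cor. III.4.11 ("`ψ^* K̄(E₃)` is fixed by every `τ_T^*`, `T ∈ ker φ`, so
`ψ^* K̄(E₃) ⊆ φ^* K̄(E₂)`"). [cite: SilvermanAEC2009, Cor. III.4.11 (proof)] -/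
theorem pullback_mem_pullbackField_of_ker_le [W'.IsElliptic] (φ : Isogeny W W')
    (hdeg : φ.deg ≤ Nat.card φ.toAddMonoidHom.ker) (ψ : Isogeny W W'')
    (hker : ∀ P : W.geomPoints, φ P = 0 → ψ P = 0) :
    ψ.pullbackX ∈ φ.pullbackField ∧ ψ.pullbackY ∈ φ.pullbackField := by
  rw [φ.pullbackField_eq_fixedField_of_deg_le hdeg]
  exact ⟨φ.mem_fixedField_of_forall_transAlgHom_eq fun T hT ↦ ψ.transAlgHom_pullbackX (hker T hT),
    φ.mem_fixedField_of_forall_transAlgHom_eq fun T hT ↦ ψ.transAlgHom_pullbackY (hker T hT)⟩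

/-- **Silverman, *AEC*, Cor. III.4.11, with the surjectivity of `φ` as a hypothesis** (removed in
`exists_eq_comp_of_ker_le` below by Thm. II.2.3). Let `φ : E → E'` and `ψ : E → E''` be isogenies
over `K` with `ker φ ⊆ ker ψ` (on `K̄`-points), assume `deg φ ≤ #ker φ` — Silverman's hypothesis
"`φ` separable" (Thm. III.4.10(c)) — and that `φ` maps `E(K̄)` onto `E'(K̄)`. Then `ψ = λ ∘ φ` for
an isogeny `λ : E' → E''` over `K`.

*Proof.* `λ(φ P) := ψ(P)` is a well-defined additive, `Γ_K`-equivariant map `E'(K̄) → E''(K̄)`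
with finite kernel `φ(ker ψ)`. It is algebraic: by `pullback_mem_pullbackField_of_ker_le`,
`ψ^* x'' = φ^* u₀`, `ψ^* y'' = φ^* v₀` with `u₀ = g₁/h₁`, `v₀ = g₂/h₂ ∈ K̄(E')` ("the inclusion
`ψ^* K̄(E₃) ⊆ φ^* K̄(E₂)` gives `λ`", Thm. II.2.4(b)), and comparing values at `P`
(`(ψ^* x'')(P) = x''(ψ P)`, `(φ^* u₀)(P) = u₀(φ P)`, `HasValueAt.pullbackHom`) shows that `λ`
agrees with `(g₁/h₁, g₂/h₂)` at `φ P` for every `P` off a finite set, i.e. off a finite set of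
`Q = φ P`. [cite: SilvermanAEC2009, Cor. III.4.11] -/
theorem exists_eq_comp_of_ker_le_of_surjective [W'.IsElliptic] (φ : Isogeny W W')
    (hdeg : φ.deg ≤ Nat.card φ.toAddMonoidHom.ker) (hsurj : Function.Surjective φ)
    (ψ : Isogeny W W'') (hker : ∀ P : W.geomPoints, φ P = 0 → ψ P = 0) :
    ∃ lam : Isogeny W' W'', ∀ P, ψ P = lam (φ P) := by
  -- `ψ^* x'' = φ^* (g₁/h₁)`, `ψ^* y'' = φ^* (g₂/h₂)`
  obtain ⟨hxL, hyL⟩ := φ.pullback_mem_pullbackField_of_ker_le hdeg ψ hker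
  obtain ⟨u₀, hu₀⟩ := (φ.mem_pullbackField_iff _).mp hxL
  obtain ⟨v₀, hv₀⟩ := (φ.mem_pullbackField_iff _).mp hyL
  obtain ⟨g₁, h₁, hh₁, rfl⟩ := exists_eq_evalGeneric_div u₀
  obtain ⟨g₂, h₂, hh₂, rfl⟩ := exists_eq_evalGeneric_div v₀
  -- the map `λ`
  choose pre hpre using hsurj
  have hwd : ∀ P Q : W.geomPoints, φ P = φ Q → ψ P = ψ Q := by
    intro P Q hPQ
    rw [← sub_eq_zero, ← map_sub]
    exact hker _ (by rw [map_sub, hPQ, sub_self])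
  let lam : W'.geomPoints →+ W''.geomPoints :=
    { toFun := fun Q ↦ ψ (pre Q)
      map_zero' := by
        change ψ (pre 0) = 0
        rw [← map_zero ψ]
        exact hwd _ _ (by rw [hpre 0, map_zero])
      map_add' := fun Q₁ Q₂ ↦ by
        change ψ (pre (Q₁ + Q₂)) = ψ (pre Q₁) + ψ (pre Q₂)
        rw [← map_add]
        exact hwd _ _ (by rw [map_add, hpre, hpre, hpre]) }
  have hlam : ∀ P : W.geomPoints, lam (φ P) = ψ P := fun P ↦ hwd _ _ (hpre _)
  -- the finite bad set of `P`'s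
  set B : Set W.geomPoints :=
    {P | ¬ AgreesWithRationalMapAt W W'' ψ.rationalRep.P₁ ψ.rationalRep.Q₁ ψ.rationalRep.P₂
        ψ.rationalRep.Q₂ ψ P} ∪
      {P | ¬ AgreesWithRationalMapAt W W' φ.rationalRep.P₁ φ.rationalRep.Q₁ φ.rationalRep.P₂
        φ.rationalRep.Q₂ φ P} ∪
    φ ⁻¹' ({Q | Q ≠ 0 ∧ MvPolynomial.eval (xy Q) h₁ = 0} ∪
      {Q | Q ≠ 0 ∧ MvPolynomial.eval (xy Q) h₂ = 0} ∪ {0}) with hB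
  have hBfin : B.Finite := by
    refine (ψ.rationalRep.finite.union φ.rationalRep.finite).union ?_
    exact (((finite_setOf_eval_xy_eq_zero hh₁).union (finite_setOf_eval_xy_eq_zero hh₂)).union
      (Set.finite_singleton 0)).preimage' fun Q _ ↦ φ.finite_fibre Q
  -- agreement at `φ P` for `P ∉ B`
  have hagree : ∀ P ∉ B, AgreesWithRationalMapAt W' W'' g₁ h₁ g₂ h₂ lam (φ P) := by
    intro P hPB
    simp only [hB, Set.mem_union, Set.mem_preimage, Set.mem_setOf_eq,
      Set.mem_singleton_iff, not_or, not_not, not_and] at hPB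
    obtain ⟨⟨hPψ, hPφ⟩, ⟨hQ₁, hQ₂⟩, hQ0⟩ := hPB
    have hP0 : P ≠ 0 := (agreesWithRationalMapAt_iff.mp hPψ).1
    have hQ₁' : MvPolynomial.eval (xy (φ P)) h₁ ≠ 0 := fun h ↦ hQ₁ hQ0 h
    have hQ₂' : MvPolynomial.eval (xy (φ P)) h₂ ≠ 0 := fun h ↦ hQ₂ hQ0 h
    -- values at `P`
    have hvx : W.HasValueAt ψ.pullbackX P (xy (ψ P) 0) := ψ.hasValueAt_pullback_gen hPψ 0
    have hvy : W.HasValueAt ψ.pullbackY P (xy (ψ P) 1) := ψ.hasValueAt_pullback_gen hPψ 1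
    have hvx' : W.HasValueAt ψ.pullbackX P (MvPolynomial.eval (xy (φ P)) g₁ /
        MvPolynomial.eval (xy (φ P)) h₁) := by
      rw [← hu₀]
      exact HasValueAt.pullbackHom φ hPφ (hasValueAt_div hQ0 hQ₁')
    have hvy' : W.HasValueAt ψ.pullbackY P (MvPolynomial.eval (xy (φ P)) g₂ /
        MvPolynomial.eval (xy (φ P)) h₂) := by
      rw [← hv₀]
      exact HasValueAt.pullbackHom φ hPφ (hasValueAt_div hQ0 hQ₂')
    have ex := hvx.unique hP0 hvx'
    have ey := hvy.unique hP0 hvy'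
    -- `ψ P` is affine with these coordinates
    obtain ⟨-, -, -, h', e⟩ := agreesWithRationalMapAt_iff.mp hPψ
    rw [e, xy_some] at ex ey
    simp only [Matrix.cons_val_zero, Matrix.cons_val_one] at ex ey
    rw [agreesWithRationalMapAt_iff]
    refine ⟨hQ0, hQ₁', hQ₂', ex ▸ ey ▸ h', ?_⟩
    rw [hlam, e]
    congr 1
  refine ⟨{ toAddMonoidHom := lam
            isAlgebraic := ⟨g₁, h₁, g₂, h₂, ?_⟩
            equivariant := ?_
            finite_ker := ?_ }, fun P ↦ (hlam P).symm⟩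
  · -- the exceptional set is contained in `φ(B)`
    refine (hBfin.image φ).subset fun Q hQ ↦ ?_
    by_cases hPB : pre Q ∈ B
    · exact ⟨pre Q, hPB, hpre Q⟩
    · exact (hQ ((hpre Q) ▸ hagree (pre Q) hPB)).elim
  · intro σ Q
    change ψ (pre (σ • Q)) = σ • ψ (pre Q)
    rw [← ψ.map_smul]
    refine hwd _ _ ?_
    rw [hpre, φ.map_smul, hpre]
  · refine (ψ.finite_ker.image φ).subset fun Q hQ ↦ ⟨pre Q, ?_, hpre Q⟩
    have hQ' : ψ (pre Q) = 0 := hQ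
    simpa using hQ'

end Isogeny

end Factor

/-! ## Cor. III.4.11 for separable isogenies; Thm. III.4.10(c) -/

section Separable

variable [W.IsElliptic] [W'.IsElliptic]

namespace Isogeny

variable (φ : Isogeny W W')

/-- **Silverman, *AEC*, Cor. III.4.11.** Let `φ : E → E'` and `ψ : E → E''` be isogenies of
elliptic curves over `K` with `ker φ ⊆ ker ψ` (on `K̄`-points) and `deg φ ≤ #ker φ` (i.e. `φ`
separable, `deg_le_card_ker_iff_isSeparable`). Then `ψ = λ ∘ φ` for an isogeny `λ : E' → E''`
over `K` (`exists_eq_comp_of_ker_le_of_surjective` with Thm. II.2.3, `Isogeny.surjective`).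
[cite: SilvermanAEC2009, Cor. III.4.11] -/
theorem exists_eq_comp_of_ker_le {W'' : WeierstrassCurve K} (ψ : Isogeny W W'')
    (hdeg : φ.deg ≤ Nat.card φ.toAddMonoidHom.ker)
    (hker : ∀ P : W.geomPoints, φ P = 0 → ψ P = 0) :
    ∃ lam : Isogeny W' W'', ∀ P, ψ P = lam (φ P) :=
  φ.exists_eq_comp_of_ker_le_of_surjective hdeg φ.surjective ψ hker

/-- **`deg φ ≤ #ker φ` iff `K̄(E)/φ^* K̄(E')` is separable** (iff `deg φ = #ker φ`): by the tree's
`#ker φ = deg_s φ` (*AEC* Thm. III.4.10(a), `card_ker_eq_finSepDegree_holds`) and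
`deg_s ∣ deg` with equality iff the extension is separable (Mathlib's
`Field.finSepDegree_eq_finrank_iff`). Silverman, *AEC*, Thm. III.4.10(c) (`φ` separable iff
`#ker φ = deg φ`). [cite: SilvermanAEC2009, Thm. III.4.10(c)] -/
theorem deg_le_card_ker_iff_isSeparable :
    φ.deg ≤ Nat.card φ.toAddMonoidHom.ker ↔
      Algebra.IsSeparable φ.pullbackField W.geomFunctionField := by
  haveI : FiniteDimensional φ.pullbackField W.geomFunctionField :=
    finiteDimensional_pullbackField_holds W W' φ
  rw [card_ker_eq_finSepDegree_holds W W' φ, ← Field.finSepDegree_eq_finrank_iff, Isogeny.deg]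
  constructor
  · exact fun h ↦ le_antisymm (Field.finSepDegree_le_finrank _ _) h
  · exact fun h ↦ h.ge

/-- **Silverman, *AEC*, Cor. III.4.11, separable form**: `ker φ ⊆ ker ψ` with `K̄(E)/φ^* K̄(E')`
separable ⟹ `ψ = λ ∘ φ`. [cite: SilvermanAEC2009, Cor. III.4.11] -/
theorem exists_eq_comp_of_ker_le_of_isSeparable {W'' : WeierstrassCurve K} (ψ : Isogeny W W'')
    [Algebra.IsSeparable φ.pullbackField W.geomFunctionField]
    (hker : ∀ P : W.geomPoints, φ P = 0 → ψ P = 0) :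
    ∃ lam : Isogeny W' W'', ∀ P, ψ P = lam (φ P) :=
  φ.exists_eq_comp_of_ker_le ψ (φ.deg_le_card_ker_iff_isSeparable.mpr ‹_›) hker

end Isogeny

/-- `deg [m] ≤ #ker [m]` for `m ≠ 0` in `K` (both are `m²`: the tree's `Isogeny.deg_zsmul`,
*AEC* III.6.2(d), and `Isogeny.degree_zsmul`, III.6.4(b)). [folklore] -/
theorem deg_zsmul_le_card_ker {m : ℤ} (hm : (m : K) ≠ 0) (hm0 : m ≠ 0) :
    (Isogeny.zsmul W m hm0).deg ≤ Nat.card (Isogeny.zsmul W m hm0).toAddMonoidHom.ker := by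
  have hdeg : Nat.card (Isogeny.zsmul W m hm0).toAddMonoidHom.ker = m.natAbs ^ 2 :=
    Isogeny.degree_zsmul W m hm
  rw [hdeg, Isogeny.deg_zsmul hm0 hm]

/-- **`[m]` is separable for `m ≠ 0` in `K`**: `K̄(E)/[m]^* K̄(E)` is a separable extension
(`deg [m] = #ker [m]` and `Isogeny.deg_le_card_ker_iff_isSeparable`). Silverman, *AEC*,
Cor. III.5.4. [cite: SilvermanAEC2009, Cor. III.5.4] -/
theorem isSeparable_pullbackField_zsmul {m : ℤ} (hm : (m : K) ≠ 0) (hm0 : m ≠ 0) :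
    Algebra.IsSeparable (Isogeny.zsmul W m hm0).pullbackField W.geomFunctionField :=
  (Isogeny.zsmul W m hm0).deg_le_card_ker_iff_isSeparable.mp (deg_zsmul_le_card_ker hm hm0)

end Separable

/-! ## The dual isogeny of a separable isogeny (Silverman, *AEC*, Thm. III.6.1(a)), any characteristic -/

section Dual

variable [W.IsElliptic] [W'.IsElliptic]

/-- **The dual of a separable isogeny** (Silverman, *AEC*, Thm. III.6.1(a) and its proof,
Thm. III.6.2(a)): if `φ : E → E'` is an isogeny of elliptic curves over `K` with `deg φ ≤ #ker φ`
(`φ` separable), and `n = #ker φ`, there is an isogeny `φ̂ : E' → E` over `K` with `φ̂ ∘ φ = [n]`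
and `φ ∘ φ̂ = [n]`: `[n]` kills `ker φ` (Lagrange), so `[n] = φ̂ ∘ φ` by Cor. III.4.11
(`exists_eq_comp_of_ker_le`), and `φ (φ̂ (φ P)) = φ (n • P) = n • φ P` with `φ` onto (II.2.3).
[cite: SilvermanAEC2009, Thm. III.6.1(a) (proof) and Thm. III.6.2(a)] -/
theorem Isogeny.exists_dual_of_deg_le_card_ker (φ : Isogeny W W')
    (hdeg : φ.deg ≤ Nat.card φ.toAddMonoidHom.ker) :
    ∃ f : Isogeny W' W, (∀ P, f (φ P) = Nat.card φ.toAddMonoidHom.ker • P) ∧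
      ∀ Q, φ (f Q) = Nat.card φ.toAddMonoidHom.ker • Q := by
  set n := Nat.card φ.toAddMonoidHom.ker with hn
  have hn0 : n ≠ 0 := (Nat.card_pos (α := φ.toAddMonoidHom.ker)).ne'
  have hker : ∀ P : W.geomPoints, φ P = 0 → Isogeny.nsmul W n hn0 P = 0 := by
    intro P hP
    rw [Isogeny.nsmul_apply]
    have hP' : P ∈ φ.toAddMonoidHom.ker := hP
    have h0 := congrArg Subtype.val (card_nsmul_eq_zero' (x := (⟨P, hP'⟩ : φ.toAddMonoidHom.ker)))
    simp only [AddSubgroupClass.coe_nsmul, ZeroMemClass.coe_zero] at h0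
    exact h0
  obtain ⟨f, hf⟩ := φ.exists_eq_comp_of_ker_le (Isogeny.nsmul W n hn0) hdeg hker
  refine ⟨f, fun P ↦ ?_, fun Q ↦ ?_⟩
  · rw [← hf P, Isogeny.nsmul_apply]
  · obtain ⟨P, rfl⟩ := φ.surjective Q
    rw [← hf P, Isogeny.nsmul_apply, map_nsmul]

/-- **Isogeny of elliptic curves is symmetric for separable isogenies** (any characteristic): an
isogeny with `deg φ ≤ #ker φ` admits an isogeny in the opposite direction. Silverman, *AEC*,
Thm. III.6.1(a). [cite: SilvermanAEC2009, Thm. III.6.1(a)] -/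
theorem Isogeny.nonempty_symm_of_deg_le_card_ker (φ : Isogeny W W')
    (hdeg : φ.deg ≤ Nat.card φ.toAddMonoidHom.ker) : Nonempty (Isogeny W' W) := by
  obtain ⟨f, -, -⟩ := φ.exists_dual_of_deg_le_card_ker hdeg
  exact ⟨f⟩

end Dual

end WeierstrassCurve
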